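import Summits.Ventures.PackingBounds.SphericalCodes.DegreeThreeEquality
import Mathlib.LinearAlgebra.Matrix.Charpoly.Coeff
import Mathlib.LinearAlgebra.Matrix.ToLinearEquiv
import Mathlib.RingTheory.Polynomial.RationalRoot
import Mathlib.LinearAlgebra.FiniteDimensional.Lemmas

/-!
# Balanced two-distance sets: the spectral (Larman–Rogers–Seidel) integrality condition

Framing: lottery ticket; floor = certified bounds/negative ranges. Venture `PackingBounds`
(cell `pub-packcert`), spherical-code family; the third obstruction behind the `L − 1` rows of the
cell's standard-angle grid, catching the integral Levenshtein cells whose valencies ARE natural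
numbers: `(9, 1/9)`, `(10, 1/5)`, `(15, 1/6)`, `(16, 1/8)`.

**Theorem (spectral integrality; the Larman–Rogers–Seidel 1977 condition for rational inner
products).** Let `C ⊂ S^{n-1}` be a two-distance set with rational inner products `s ≠ -a` and
`|C| ≥ n + 2`. Then `(1 + a)/(s + a)` is an integer. Proof: the linear map
`v ↦ (Σ v_i x_i, Σ v_i)` from `ℝ^C` to `ℝ^n × ℝ` has a nonzero kernel vector `v`; pairing
`Σ v_i x_i = 0` with each `x ∈ C` and using `Σ v_i = 0` gives `A v = -k v` for the `0/1` adjacency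
matrix `A` of the relation `⟨x, y⟩ = s` and `k = (1+a)/(s+a)`; so `-k` is a root of the (monic,
integer) characteristic polynomial of `A`, hence an integer (integral root theorem).
With the LP equality case (`Literature…DelsarteLP.sum_eq_zero_of_card_mul_eq`: a code attaining a
sharp cubic certificate `(t - s)(t + a)²` has all inner products in `{s, -a}`) this yields
`degree_three_card_le_of_ratio`: if `(1+a)/(s+a) ∉ ℤ` and `N ≥ n + 2` then `A(n, s) ≤ N - 1`, and the rows
`A(9, arccos 1/9) ≤ 27`, `A(10, arccos 1/5) ≤ 55`, `A(15, arccos 1/6) ≤ 99`, `A(16, arccos 1/8) ≤ 76`.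

## References
* D. G. Larman, C. A. Rogers, J. J. Seidel, *On two-distance sets in Euclidean space*, Bull. London
  Math. Soc. 9 (1977) 261–267 (the integrality condition `k = b²/(b²-c²) ∈ ℤ`).
* P. Delsarte, J. M. Goethals, J. J. Seidel, Geom. Dedicata 6 (1977) 363–388, §4. [`DelsarteGoethalsSeidel1977`]
* P. Boyvalenkov, I. Landgev, *On maximal spherical codes I*, LNCS 948 (1995) 158–168.
-/

noncomputable section

namespace Summit.Ventures.PackingBounds.SphericalCodes

open Finset Literature.Analysis.SpecialFunctions Literature.Geometry.DiscreteGeometry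
open scoped RealInnerProductSpace

/-- **Spectral integrality for two-distance sets with rational inner products.** If `C ⊂ S^{n-1}`
(`|C| ≥ n + 2`) has all inner products of distinct points in `{s, -a}` with `s, a ∈ ℚ`, `s ≠ -a`, then
`(1 + a)/(s + a)` is an integer: some `v ≠ 0` with `Σ v_i x_i = 0`, `Σ v_i = 0` exists by dimension
count, and pairing with each `x ∈ C` shows `-(1+a)/(s+a)` is an eigenvalue of the integer adjacency
matrix of the relation `⟨x,y⟩ = s` (integral root theorem). (Larman–Rogers–Seidel 1977 integrality
condition, in the form: rational non-integral ratio forces `|C| ≤ n + 1`.) -/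
theorem two_distance_ratio_integer {n : ℕ} (s a : ℚ) (hsa : s ≠ -a)
    (C : Finset (EuclideanSpace ℝ (Fin n))) (h1 : ∀ x ∈ C, ‖x‖ = 1)
    (htwo : ∀ x ∈ C, ∀ y ∈ C, x ≠ y → inner ℝ x y = (s : ℝ) ∨ inner ℝ x y = -(a : ℝ))
    (hcard : n + 2 ≤ C.card) :
    ∃ m : ℤ, (m : ℚ) = (1 + a) / (s + a) := by
  classical
  have hsa' : (s : ℝ) + a ≠ 0 := by
    have : (s : ℚ) + a ≠ 0 := fun h => hsa (by linarith)
    exact_mod_cast this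
  -- Step A: a nonzero `v : C → ℝ` with `Σ v_i x_i = 0` and `Σ v_i = 0`
  set Ψ : (C → ℝ) →ₗ[ℝ] (EuclideanSpace ℝ (Fin n) × ℝ) :=
    (Fintype.linearCombination ℝ (fun i : C => (i : EuclideanSpace ℝ (Fin n)))).prod
      (Fintype.linearCombination ℝ (fun _ : C => (1 : ℝ))) with hΨdef
  have hdim : Module.finrank ℝ (EuclideanSpace ℝ (Fin n) × ℝ) < Module.finrank ℝ (C → ℝ) := by
    rw [Module.finrank_prod, finrank_euclideanSpace, Fintype.card_fin, Module.finrank_self,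
      Module.finrank_fintype_fun_eq_card, Fintype.card_coe]
    omega
  obtain ⟨v, hvker, hv0⟩ :=
    Submodule.exists_mem_ne_zero_of_ne_bot (LinearMap.ker_ne_bot_of_finrank_lt hdim (f := Ψ))
  have hΨ : Ψ v = 0 := LinearMap.mem_ker.1 hvker
  have hΨv : Ψ v = (∑ i : C, v i • (i : EuclideanSpace ℝ (Fin n)), ∑ i : C, v i • (1 : ℝ)) := by
    rw [hΨdef, LinearMap.coe_prod, Function.prod_apply, Fintype.linearCombination_apply,
      Fintype.linearCombination_apply]
  have hsumvec : ∑ i : C, v i • (i : EuclideanSpace ℝ (Fin n)) = 0 := by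
    have h := congrArg Prod.fst hΨ
    rw [hΨv] at h
    simpa using h
  have hsum : ∑ i : C, v i = 0 := by
    have h := congrArg Prod.snd hΨ
    rw [hΨv] at h
    simpa using h
  -- Step B: `Σ_{y ~ x} v_y = -k v_x` for every `x`, with `k = (1+a)/(s+a)`
  set k : ℝ := (1 + (a : ℝ)) / ((s : ℝ) + a) with hk
  have adjrel : ∀ x : C,
      ∑ y : C, (if (x ≠ y ∧ inner ℝ (x : EuclideanSpace ℝ (Fin n)) (y : EuclideanSpace ℝ (Fin n)) = (s : ℝ))
        then v y else 0) = -k * v x := by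
    intro x
    have hin : inner ℝ (x : EuclideanSpace ℝ (Fin n)) (∑ y : C, v y • (y : EuclideanSpace ℝ (Fin n))) = 0 := by
      rw [hsumvec, inner_zero_right]
    rw [inner_sum] at hin
    simp_rw [real_inner_smul_right] at hin
    have hpt : ∀ y : C, v y * inner ℝ (x : EuclideanSpace ℝ (Fin n)) (y : EuclideanSpace ℝ (Fin n)) =
        (1 + (a : ℝ)) * (if y = x then v y else 0)
          + ((s : ℝ) + a) * (if (x ≠ y ∧ inner ℝ (x : EuclideanSpace ℝ (Fin n)) (y : EuclideanSpace ℝ (Fin n)) = (s : ℝ))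
              then v y else 0)
          - (a : ℝ) * v y := by
      intro y
      by_cases hyx : y = x
      · subst hyx
        have hxx : inner ℝ (y : EuclideanSpace ℝ (Fin n)) (y : EuclideanSpace ℝ (Fin n)) = 1 := by
          rw [real_inner_self_eq_norm_sq, h1 _ y.2, one_pow]
        rw [hxx, if_pos rfl, if_neg (fun h => h.1 rfl)]
        ring
      · have hne : (x : EuclideanSpace ℝ (Fin n)) ≠ (y : EuclideanSpace ℝ (Fin n)) :=
          fun h => hyx (Subtype.ext h).symm
        rcases htwo _ x.2 _ y.2 hne with h | h
        · have hc : (x ≠ y ∧ inner ℝ (x : EuclideanSpace ℝ (Fin n)) (y : EuclideanSpace ℝ (Fin n)) = (s : ℝ)) :=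
            ⟨fun e => hyx e.symm, h⟩
          rw [if_neg hyx, if_pos hc, h]
          ring
        · have hc : ¬ (x ≠ y ∧ inner ℝ (x : EuclideanSpace ℝ (Fin n)) (y : EuclideanSpace ℝ (Fin n)) = (s : ℝ)) := by
            rintro ⟨_, h'⟩
            apply hsa'
            have : (s : ℝ) = -(a : ℝ) := h'.symm.trans h
            linarith
          rw [if_neg hyx, if_neg hc, h]
          ring
    rw [Finset.sum_congr rfl fun y _ => hpt y, Finset.sum_sub_distrib, Finset.sum_add_distrib,
      ← Finset.mul_sum, ← Finset.mul_sum, ← Finset.mul_sum, Finset.sum_ite_eq' Finset.univ x,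
      if_pos (Finset.mem_univ x), hsum, mul_zero, sub_zero] at hin
    -- hin : (1 + a) * v x + (s + a) * S = 0
    have : ((s : ℝ) + a) * (∑ y : C, (if (x ≠ y ∧ inner ℝ (x : EuclideanSpace ℝ (Fin n)) (y : EuclideanSpace ℝ (Fin n)) = (s : ℝ))
        then v y else 0)) = ((s : ℝ) + a) * (-k * v x) := by
      rw [hk]; field_simp; linarith
    exact mul_left_cancel₀ hsa' this
  -- Step C: the integer adjacency matrix and its eigenvalue `-k`
  set Az : Matrix C C ℤ := fun x y =>
    if (x ≠ y ∧ inner ℝ (x : EuclideanSpace ℝ (Fin n)) (y : EuclideanSpace ℝ (Fin n)) = (s : ℝ)) then 1 else 0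
    with hAz
  set AR : Matrix C C ℝ := Az.map (Int.castRingHom ℝ) with hARdef
  have hAR : ∀ x y, AR x y =
      if (x ≠ y ∧ inner ℝ (x : EuclideanSpace ℝ (Fin n)) (y : EuclideanSpace ℝ (Fin n)) = (s : ℝ)) then (1 : ℝ) else 0 := by
    intro x y
    rw [hARdef, Matrix.map_apply, hAz]
    dsimp only
    by_cases hc : (x ≠ y ∧ inner ℝ (x : EuclideanSpace ℝ (Fin n)) (y : EuclideanSpace ℝ (Fin n)) = (s : ℝ))
    · rw [if_pos hc, if_pos hc]; simp
    · rw [if_neg hc, if_neg hc]; simp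
  have hmul : (Matrix.scalar C (-k) - AR).mulVec v = 0 := by
    funext x
    rw [Matrix.sub_mulVec, Pi.sub_apply, Matrix.scalar_apply, Matrix.mulVec_diagonal, Pi.zero_apply]
    have hx : AR.mulVec v x =
        ∑ y : C, (if (x ≠ y ∧ inner ℝ (x : EuclideanSpace ℝ (Fin n)) (y : EuclideanSpace ℝ (Fin n)) = (s : ℝ))
          then v y else 0) := by
      rw [Matrix.mulVec, dotProduct]
      exact Finset.sum_congr rfl fun y _ => by rw [hAR]; split_ifs <;> simp
    rw [hx, adjrel x]
    ring
  have hdet : (Matrix.scalar C (-k) - AR).det = 0 :=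
    Matrix.exists_mulVec_eq_zero_iff.1 ⟨v, hv0, hmul⟩
  -- Step D: `-k` is a root of the integer characteristic polynomial, hence an integer
  have hev : (AR.charpoly).eval (-k) = 0 := by rw [Matrix.eval_charpoly]; exact hdet
  have hmapc : AR.charpoly = (Az.charpoly).map (Int.castRingHom ℝ) := by
    rw [hARdef]; exact Matrix.charpoly_map Az (Int.castRingHom ℝ)
  set kq : ℚ := (1 + a) / (s + a) with hkq
  have hkcast : ((kq : ℚ) : ℝ) = k := by rw [hkq, hk]; push_cast; rfl
  have h2 : (Az.charpoly).eval₂ (Int.castRingHom ℝ) (-k) = 0 := by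
    rw [← Polynomial.eval_map, ← hmapc]; exact hev
  have hq : (Az.charpoly).eval₂ (Int.castRingHom ℚ) (-kq) = 0 := by
    have h1 : (Rat.castHom ℝ) ((Az.charpoly).eval₂ (Int.castRingHom ℚ) (-kq)) =
        (Az.charpoly).eval₂ (Int.castRingHom ℝ) (-k) := by
      rw [Polynomial.hom_eval₂, RingHom.ext_int ((Rat.castHom ℝ).comp (Int.castRingHom ℚ)) (Int.castRingHom ℝ),
        map_neg, Rat.coe_castHom, hkcast]
    have h3 : (Rat.castHom ℝ) ((Az.charpoly).eval₂ (Int.castRingHom ℚ) (-kq)) = (Rat.castHom ℝ) 0 := by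
      rw [h1, h2, map_zero]
    exact Rat.cast_injective h3
  have haeval : Polynomial.aeval (-kq) (Az.charpoly) = 0 := by
    rw [Polynomial.aeval_def, algebraMap_int_eq]; exact hq
  obtain ⟨m, hm, -⟩ := exists_integer_of_is_root_of_monic (Matrix.charpoly_monic Az) haeval
  refine ⟨-m, ?_⟩
  rw [algebraMap_int_eq, eq_intCast] at hm
  push_cast
  linarith

/-- **No code attains a sharp cubic certificate whose eigenvalue ratio is not an integer.**
With `f(t) = (t - s)(t + a)²` admissible as in `degree_three_valency` (`s, a ∈ ℚ`, `f_0 > 0`, `f_1 > 0`,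
`s ≠ -a`) and `N · f_0 = f(1)` for a natural number `N ≥ n + 2`: if `(1 + a)/(s + a)` is not an
integer, then every code `C ⊂ S^{n-1}` with pairwise inner products `≤ s` has `|C| ≤ N - 1`
(a code with `|C| = N` would be a two-distance set `{s, -a}` by the LP equality case, and then
`two_distance_ratio_integer` applies). (LP equality case + Larman–Rogers–Seidel.) -/
theorem degree_three_card_le_of_ratio {n : ℕ} {μ : ℝ} (hnμ : (n : ℝ) = 2 * μ + 2) (hμ : 0 < μ)
    (s a : ℚ) (has : (s : ℝ) ≤ 2 * a) (hf1 : 0 < 3 / (2 * (μ + 2)) + (a : ℝ) ^ 2 - 2 * a * s)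
    (hf0 : 0 < (2 * (a : ℝ) - s) / (2 * μ + 2) - (a : ℝ) ^ 2 * s) (hsa : s ≠ -a) (N : ℕ) (hN : n + 2 ≤ N)
    (hval : (N : ℝ) * ((2 * (a : ℝ) - s) / (2 * μ + 2) - (a : ℝ) ^ 2 * s) = (1 - (s : ℝ)) * (1 + a) ^ 2)
    (hk : ∀ m : ℤ, (m : ℚ) ≠ (1 + a) / (s + a))
    (C : Finset (EuclideanSpace ℝ (Fin n)))
    (h1 : ∀ x ∈ C, ‖x‖ = 1) (h2 : ∀ x ∈ C, ∀ y ∈ C, x ≠ y → inner ℝ x y ≤ (s : ℝ)) :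
    C.card + 1 ≤ N := by
  classical
  have hsa' : (s : ℝ) ≠ -(a : ℝ) := by
    intro h; apply hsa; exact_mod_cast h
  have hle := degree_three_card_mul_le_aux hnμ hμ (s : ℝ) (a : ℝ) has hf1.le hf0.le C h1 h2
  rw [← hval] at hle
  have hcardle : (C.card : ℝ) ≤ N := le_of_mul_le_mul_right hle hf0
  have hC : C.card ≤ N := by exact_mod_cast hcardle
  rcases hC.lt_or_eq with hlt | heqN
  · omega
  · exfalso
    have heq : (C.card : ℝ) * ((2 * (a : ℝ) - s) / (2 * μ + 2) - (a : ℝ) ^ 2 * s) =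
        (1 - (s : ℝ)) * (1 + a) ^ 2 := by rw [heqN]; exact hval
    -- the cubic certificate, as in `degree_three_valency`
    have hμ1 : (0 : ℝ) < μ + 1 := by linarith
    have hμ2 : (0 : ℝ) < μ + 2 := by linarith
    have hμne : μ ≠ 0 := hμ.ne'
    have hμ1ne : μ + 1 ≠ 0 := hμ1.ne'
    have hμ2ne : μ + 2 ≠ 0 := hμ2.ne'
    have h2μ2 : (2 : ℝ) * μ + 2 ≠ 0 := by positivity
    have hC2 : ∀ t : ℝ, gegenbauerSum μ 2 t = 2 * μ * (μ + 1) * t ^ 2 - μ := by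
      intro t
      simp [gegenbauerSum, gegenbauerCoeff, Finset.sum_range_succ, Finset.prod_range_succ,
        Nat.factorial]
      ring
    have hC3 : ∀ t : ℝ, gegenbauerSum μ 3 t =
        4 / 3 * μ * (μ + 1) * (μ + 2) * t ^ 3 - 2 * μ * (μ + 1) * t := by
      intro t
      simp [gegenbauerSum, gegenbauerCoeff, Finset.sum_range_succ, Finset.prod_range_succ,
        Nat.factorial]
      ring
    set f : ℕ → ℝ := fun j => match j with
        | 0 => (2 * (a : ℝ) - s) / (2 * μ + 2) - (a : ℝ) ^ 2 * s
        | 1 => ((a : ℝ) ^ 2 - 2 * a * s) / (2 * μ) + 3 / (4 * μ * (μ + 2))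
        | 2 => (2 * (a : ℝ) - s) / (2 * μ * (μ + 1))
        | 3 => 3 / (4 * μ * (μ + 1) * (μ + 2))
        | _ => 0 with hfdef
    have hpoly : ∀ t : ℝ, ∑ j ∈ range (3 + 1), f j * gegenbauerSum μ j t =
        (t - s) * (t + a) ^ 2 := by
      intro t
      simp only [hfdef, Finset.sum_range_succ, Finset.sum_range_zero, zero_add, gegenbauerSum_zero,
        gegenbauerSum_one, hC2, hC3]
      field_simp
      ring
    have hf1' : 0 < f 1 := by
      show 0 < ((a : ℝ) ^ 2 - 2 * a * s) / (2 * μ) + 3 / (4 * μ * (μ + 2))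
      have : ((a : ℝ) ^ 2 - 2 * a * s) / (2 * μ) + 3 / (4 * μ * (μ + 2)) =
          (3 / (2 * (μ + 2)) + (a : ℝ) ^ 2 - 2 * a * s) / (2 * μ) := by
        field_simp
        ring
      rw [this]
      positivity
    have hf : ∀ j, 0 ≤ f j := by
      intro j
      show 0 ≤ (match j with
        | 0 => (2 * (a : ℝ) - s) / (2 * μ + 2) - (a : ℝ) ^ 2 * s
        | 1 => ((a : ℝ) ^ 2 - 2 * a * s) / (2 * μ) + 3 / (4 * μ * (μ + 2))
        | 2 => (2 * (a : ℝ) - s) / (2 * μ * (μ + 1))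
        | 3 => 3 / (4 * μ * (μ + 1) * (μ + 2))
        | _ => 0)
      split
      · exact hf0.le
      · exact hf1'.le
      · have : 0 ≤ 2 * (a : ℝ) - s := by linarith
        positivity
      · positivity
      · exact le_refl 0
    have hF : ∀ t : ℝ, -1 ≤ t → t ≤ s → ∑ j ∈ range (3 + 1), f j * gegenbauerSum μ j t ≤ 0 := by
      intro t ht1 ht2
      rw [hpoly]
      exact mul_nonpos_of_nonpos_of_nonneg (by linarith) (sq_nonneg _)
    have heq' : (C.card : ℝ) * f 0 = ∑ j ∈ range (3 + 1), f j * gegenbauerSum μ j 1 := by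
      rw [hpoly]; exact heq
    have htwo : ∀ x ∈ C, ∀ y ∈ C, x ≠ y → inner ℝ x y = (s : ℝ) ∨ inner ℝ x y = -(a : ℝ) := by
      intro x hx y hy hxy
      have h0 := DelsarteLP.sum_eq_zero_of_card_mul_eq hnμ hμ 3 f hf (s : ℝ) hF C h1 h2 heq' hx hy hxy
      rw [hpoly] at h0
      rcases mul_eq_zero.1 h0 with h | h
      · left; linarith
      · right
        have := pow_eq_zero_iff (n := 2) (by norm_num) |>.1 h
        linarith
    obtain ⟨m, hm⟩ := two_distance_ratio_integer s a hsa C h1 htwo (by omega)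
    exact hk m hm

end Summit.Ventures.PackingBounds.SphericalCodes

end
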